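import Summits.ValiantsHypothesis.ValiantsHypothesis.Theorems.DepthWindowHomFanIn
import Literature.Computability.AlgebraicComplexity.CircuitDepth
import Mathlib.RingTheory.MvPolynomial.Homogeneous
import HarnessLib

/-!
# Strassen homogenisation preserves product depth for bounded fan-in (circuit level)

Circuit-level corollary of `exists_hom_block_of_fanIn` (route `DepthWindow`, crux item
`HomSubReach`): a circuit computing a homogeneous polynomial `f` of degree `d` whose product
gates have fan-in `≤ F` can be replaced by one in which EVERY gate computes a homogeneous
polynomial, of product depth NO LARGER, and size `≤ size · (d + 1) · ((F + 1) ^ d + 1)`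
(`exists_homogeneous_circuit_of_fanIn`).  In the currency of the crux (`HomAt p q c₀ a` with
`p = q = 1`, `c₀ = 0`) this is homogenisation at SLOPE ONE for circuits of product fan-in `≤ F`;
for `F < 2 ^ d` the size is within the `2^{O(d²)}` budget of `HomSubReach`, so the crux's open
content is circuits with product gates of fan-in `≥ 2 ^ d` (`d ≈ √log m` in the route's regime),
where slope `1` is impossible (Nisan–Wigderson) and the Newton scheme gives slope `2`
(Limaye–Srinivasan–Tavenas).

[cite: Strassen1973, §3] [cite: Raz2013, §2] [cite: LimayeSrinivasanTavenas2025, Lemma 11, Lemma 19]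
[cite: NisanWigderson1996, Thm. 1] [cite: Burgisser2000, Def. 2.1]
-/

set_option linter.dupNamespace false

namespace Summit.ValiantsHypothesis.ValiantsHypothesis.Theorems.DepthWindow

open MvPolynomial Literature.Computability.AlgebraicComplexity ArithCircuit

variable {k : Type*} [CommSemiring k] {σ : Type*}

/-- **Strassen's homogenisation, product-depth-preserving form, bounded fan-in.**  If `D`
computes a homogeneous `f` of degree `d` and every product gate of `D` has fan-in `≤ F`, then some
circuit `D'` computes `f` with every gate value homogeneous, `productDepth D' ≤ productDepth D`
and `size D' ≤ size D · ((d + 1) · ((F + 1) ^ d + 1))`.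
[cite: Strassen1973, §3] [cite: Raz2013, §2] [cite: LimayeSrinivasanTavenas2025, Lemma 19] -/
theorem exists_homogeneous_circuit_of_fanIn (F d : ℕ) (f : MvPolynomial σ k)
    (hf : f.IsHomogeneous d) (D : ArithCircuit k σ) (hD : D.Computes f)
    (hF : ∀ us : List (Operand k σ), Gate.prod us ∈ D.gates → us.length ≤ F) :
    ∃ D' : ArithCircuit k σ, D'.Computes f ∧
      (∀ g ∈ gateValues D'.gates, ∃ e : ℕ, g.IsHomogeneous e) ∧
      D'.productDepth ≤ D.productDepth ∧
      D'.size ≤ D.size * ((d + 1) * ((F + 1) ^ d + 1)) := by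
  obtain ⟨Ψ, out, hhom, hlen, -, hout⟩ :=
    exists_hom_block_of_fanIn (k := k) F (1 : σ → ℕ) d D.gates hF
  have hvals : (gateValues D.gates).length = D.gates.length := gateValues_length D.gates
  refine ⟨⟨Ψ, cop (1 : σ → ℕ) D.gates.length out D.output d⟩, ?_, ?_, ?_, ?_⟩
  · -- computes `f`: the output is the degree-`d` component of `D`'s output, which is `f`
    show (cop (1 : σ → ℕ) D.gates.length out D.output d).eval (gateValues Ψ) = f
    rw [eval_cop (1 : σ → ℕ) D.gates.length d out (gateValues Ψ) (gateValues D.gates) hvals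
      (fun j e hj he => (hout j e hj he).2.1) D.output d le_rfl]
    have hDf : D.output.eval (gateValues D.gates) = f := hD
    rw [hDf]
    exact hf.weightedHomogeneousComponent_same
  · -- every gate homogeneous (`IsHomogeneous = IsWeightedHomogeneous 1`)
    intro g hg
    obtain ⟨e, he⟩ := hhom g hg
    exact ⟨e, he⟩
  · -- product depth does not grow
    show (cop (1 : σ → ℕ) D.gates.length out D.output d).depthIn (gateWDepths prodWeight Ψ) ≤
      D.output.depthIn (gateWDepths prodWeight D.gates)
    exact depthIn_cop (1 : σ → ℕ) D.gates.length d out (gateWDepths prodWeight Ψ)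
      (gateWDepths prodWeight D.gates) (fun j e hj he => (hout j e hj he).2.2) D.output d le_rfl
  · exact hlen

/-- Size arithmetic: for `F + 1 ≤ 2 ^ d` the Strassen size factor is within the `HomSubReach`
budget with exponent `a = 2`: `S · ((d+1) · ((F+1)^d + 1)) ≤ (S + c + 2) ^ 2 · 2 ^ (2 · d · d)`. -/
theorem strassen_size_le (S c F d : ℕ) (hF : F + 1 ≤ 2 ^ d) :
    S * ((d + 1) * ((F + 1) ^ d + 1)) ≤ (S + c + 2) ^ 2 * 2 ^ (2 * d * d) := by
  have h1 : (F + 1) ^ d ≤ 2 ^ (d * d) := pow_fanIn_le F d hF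
  have h2 : d + 1 ≤ 2 ^ d := Nat.succ_le_of_lt Nat.lt_two_pow_self
  have h3 : 2 ^ d ≤ 2 ^ (d * d) := Nat.pow_le_pow_right (by norm_num) (Nat.le_mul_self d)
  have h4 : (d + 1) * ((F + 1) ^ d + 1) ≤ 2 ^ (d * d) * (2 ^ (d * d) + 1) :=
    Nat.mul_le_mul (h2.trans h3) (Nat.add_le_add_right h1 1)
  have h5 : 2 ^ (d * d) * (2 ^ (d * d) + 1) ≤ 2 * 2 ^ (2 * d * d) := by
    have : 2 ^ (2 * d * d) = 2 ^ (d * d) * 2 ^ (d * d) := by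
      rw [← pow_add]; congr 1; ring
    rw [this]
    have hpos : 1 ≤ 2 ^ (d * d) := Nat.one_le_two_pow
    nlinarith
  calc S * ((d + 1) * ((F + 1) ^ d + 1))
      ≤ S * (2 * 2 ^ (2 * d * d)) := Nat.mul_le_mul_left S (h4.trans h5)
    _ = (2 * S) * 2 ^ (2 * d * d) := by ring
    _ ≤ (S + c + 2) ^ 2 * 2 ^ (2 * d * d) := by
        apply Nat.mul_le_mul_right
        calc 2 * S ≤ (S + c + 2) * (S + c + 2) := Nat.mul_le_mul (by omega) (by omega)
          _ = (S + c + 2) ^ 2 := (sq _).symm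

/-- **Slope one for bounded fan-in, in the crux's currency.**  For circuits whose product gates
have fan-in `< 2 ^ d` (`d` = the degree of the homogeneous target), homogenisation costs NO
product depth: the `HomSubReach` conclusion holds with `p = q = 1`, `c₀ = 0`, `a = 2`.
[cite: Strassen1973, §3] [cite: Raz2013, §2] [cite: LimayeSrinivasanTavenas2025, Lemma 11, Lemma 19] -/
theorem homSubReach_shape_of_fanIn [Fintype σ] (d : ℕ) (f : MvPolynomial σ k)
    (hf : f.IsHomogeneous d) (D : ArithCircuit k σ) (hD : D.Computes f)
    (hF : ∀ us : List (Operand k σ), Gate.prod us ∈ D.gates → us.length + 1 ≤ 2 ^ d) :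
    ∃ D' : ArithCircuit k σ, D'.Computes f ∧
      (∀ g ∈ gateValues D'.gates, ∃ e : ℕ, g.IsHomogeneous e) ∧
      D'.productDepth ≤ 1 * D.productDepth / 1 + 0 ∧
      D'.size ≤ (D.size + Fintype.card σ + 2) ^ 2 * 2 ^ (2 * d * d) := by
  obtain ⟨D', hc, hh, hpd, hsz⟩ :=
    exists_homogeneous_circuit_of_fanIn (2 ^ d - 1) d f hf D hD
      (fun us hus => by have := hF us hus; omega)
  refine ⟨D', hc, hh, by simpa using hpd, hsz.trans ?_⟩
  have h2d : 2 ^ d - 1 + 1 ≤ 2 ^ d := by have := Nat.one_le_two_pow (n := d); omega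
  exact strassen_size_le D.size (Fintype.card σ) (2 ^ d - 1) d h2d

end Summit.ValiantsHypothesis.ValiantsHypothesis.Theorems.DepthWindow
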